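import Summits.Ventures.CertifiedManyBodySolver.Downfold.EmeryAxialResolventSecant
import Mathlib.Analysis.Convex.Deriv
import HarnessLib

/-!
# The Hellmann–Feynman splitting bracket IS a theorem in the sign regime: convexity of the resolvent function `axialLin/minor4S` from
# `(axialLin/minor4S)″·minor4S³ = 8u·minor4S² + 2·axialLin·minor4S·(3ε + 2Δ + 4t_pp′u) + 2·resolventNum·∂_εcharCubic ≥ 0`

Venture CertifiedManyBodySolver, cell `pub/hubbard-downfold` (stage S1; INFLATION-RULES-3to1-B §B.80 (e′)), seat hubbard-downfold-mod-4 (technique B, g32); namespace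
`Summit.Ventures.CertifiedManyBodySolver.Downfold.Emery`. Sequel of `EmeryAxialResolventSecant` (`hf_lower_iff` / `hf_upper_iff`: the bracket
`Δℓ·w_s(upper state) ≤ Δε ≤ Δℓ·w_s(lower state)` ⟺ two-point convexity of `axialLin/minor4S`). Everything PROVED (0 sorry): `ring` identities for the second derivative,
sign bookkeeping, Mathlib's `MonotoneOn.convexOn_of_deriv`, `monotoneOn_of_deriv_nonneg`, `ConvexOn.le_slope_of_hasDerivAt` / `slope_le_of_hasDerivAt`.
WHAT THIS IS NOT: a statement about any material; U = 0 one-body algebra of the `(d, s, p_x, p_y; t_pp, t_pp′)` model.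

* §1 second-derivative structure: `∂_ε daxialLin = 8u`, `∂_ε(∂_εcharCubic) = 2(3ε + 2Δ + 4t_pp′u)` (`ddcharCubic`), `∂_ε resolventNum = 8u·minor4S + axialLin·ddcharCubic`
  (`dresolventNum`), and **`∂_ε(resolventNum/minor4S²) = resolventConv/minor4S³`** with `resolventConv := 8u·m² + 2·axialLin·m·(3ε + 2Δ + 4t_pp′u) + 2·resolventNum·∂_εcharCubic`
  (`hasDerivAt_resolventSlope`).
* §2 **THE SIGN REGIME**: `x, y ≥ 0`, `minor4S ≥ 0` (below the σ band energy at that `k`), `axialLin ≥ 0`, `∂_εcharCubic ≥ 0` (positive σ velocity denominator), `3ε + 2Δ + 4t_pp′u ≥ 0`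
  (automatic for `ε, Δ, t_pp′ ≥ 0`) ⟹ `resolventConv ≥ 0` (`resolventConv_nonneg`): every term is a product of non-negative factors (`resolventNum` is the §B.80 (c) sum of squares).
* §3 hence on an energy window where the regime holds throughout, `axialLin/minor4S` is CONVEX (`resolvent_convexOn`), and
* §4 **THE HELLMANN–FEYNMAN BRACKET THEOREM** (`hf_bracket_of_signs`): two four-orbital band points `(ε₁; ℓ₁)`, `(ε₂; ℓ₂)` at the same `k`, `T > 0` with `ε₁ < ε₂` and the sign regime on
  `[ε₁, ε₂]` satisfy **`(ℓ₂ − ℓ₁)·w_s(state 2) ≤ ε₂ − ε₁ ≤ (ℓ₂ − ℓ₁)·w_s(state 1)`** — for the pure `s–s` bilayer (`ℓ₂ − ℓ₁ = 2t⊥_ss`): the EXACT splitting at fixed `k`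
  lies between `2t⊥_ss` times the Cu-4s weights of the two actual states (`bilayer_hf_bracket`). The regime is the physical one: it holds on 844/845 sampled configurations
  of the box of §B.80 (e) (float, `bilayer-g32/explore`), the one exception failing `∂_εcharCubic ≥ 0` at the odd end.
* §5 (appended) THE INVERSE READING `tss_bracket_of_exact_split`: `Δε/(2w_s(odd state)) ≤ t⊥_ss ≤ Δε/(2w_s(even state))` — a one-band `tperp` row read back to the
  four-orbital coupling carries the two sheets' Cu-4s weights as an explicit two-sided inflation (`tss_bracket_ratio`: upper/lower = `w_s(odd)/w_s(even)`).

Sources: [AndersenEtAl1995, Eqs. (2), (5), (24)]; [folklore] convex analysis.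
-/

noncomputable section

namespace Summit.Ventures.CertifiedManyBodySolver.Downfold.Emery

open Real Set

/-! ## §1 Second-derivative structure -/

/-- `∂_ε daxialLin = 8(x + y)`. [folklore] -/
theorem hasDerivAt_daxialLin_eps (Δ tpp c x y ε : ℝ) :
    HasDerivAt (fun e => daxialLin Δ tpp c x y e) (8 * (x + y)) ε := by
  have h : (fun e => daxialLin Δ tpp c x y e) = fun e => (8 * (x + y)) * e + (4 * Δ * (x + y) - 32 * (tpp - c) * (x * y)) := by
    funext e; unfold daxialLin; ring
  rw [h]
  have := ((hasDerivAt_id' ε).const_mul (8 * (x + y))).add_const (4 * Δ * (x + y) - 32 * (tpp - c) * (x * y))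
  simpa using this

/-- `∂_ε(∂_ε charCubic) = 2(3ε + 2Δ + 4t_pp′(x + y))`. [folklore] -/
def ddcharCubic (Δ c x y ε : ℝ) : ℝ := 2 * (3 * ε + 2 * Δ + 4 * c * (x + y))

/-- `d dcharCubic/dε = ddcharCubic`. [folklore] -/
theorem hasDerivAt_dcharCubic_eps (Δ tpd tpp c x y ε : ℝ) :
    HasDerivAt (fun e => dcharCubic Δ tpd tpp c x y e) (ddcharCubic Δ c x y ε) ε := by
  have h : (fun e => dcharCubic Δ tpd tpp c x y e) =
      fun e => 3 * e ^ 2 + (4 * Δ + 8 * c * (x + y)) * e + (Δ ^ 2 - 4 * (tpd ^ 2 - c * Δ) * (x + y) - 16 * (tpp ^ 2 - c ^ 2) * (x * y)) := by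
    funext e; unfold dcharCubic dcA dfsD dfsN; ring
  rw [h]
  have h1 := ((hasDerivAt_pow 2 ε).const_mul 3).add (((hasDerivAt_id' ε).const_mul (4 * Δ + 8 * c * (x + y))).add_const
    (Δ ^ 2 - 4 * (tpd ^ 2 - c * Δ) * (x + y) - 16 * (tpp ^ 2 - c ^ 2) * (x * y)))
  have e2 : (fun e => 3 * e ^ 2 + (4 * Δ + 8 * c * (x + y)) * e + (Δ ^ 2 - 4 * (tpd ^ 2 - c * Δ) * (x + y) - 16 * (tpp ^ 2 - c ^ 2) * (x * y))) =
      fun e => 3 * e ^ 2 + ((4 * Δ + 8 * c * (x + y)) * e + (Δ ^ 2 - 4 * (tpd ^ 2 - c * Δ) * (x + y) - 16 * (tpp ^ 2 - c ^ 2) * (x * y))) := by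
    funext e; ring
  rw [e2]
  refine h1.congr_deriv ?_
  unfold ddcharCubic; simp; ring

/-- `∂_ε resolventNum = 8u·minor4S + axialLin·ddcharCubic` (the `L′m′` terms cancel). [folklore] -/
def dresolventNum (Δ tpd tpp c x y ε : ℝ) : ℝ :=
  8 * (x + y) * minor4S Δ tpd tpp c x y ε + axialLin Δ tpd tpp c x y ε * ddcharCubic Δ c x y ε

/-- `d resolventNum/dε = dresolventNum`. [folklore] -/
theorem hasDerivAt_resolventNum_eps (Δ tpd tpp c x y ε : ℝ) :
    HasDerivAt (fun e => resolventNum Δ tpd tpp c x y e) (dresolventNum Δ tpd tpp c x y ε) ε := by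
  have hL := hasDerivAt_axialLin_eps Δ tpd tpp c x y ε
  have hdL := hasDerivAt_daxialLin_eps Δ tpp c x y ε
  have hM := hasDerivAt_minor4S_eps Δ tpd tpp c x y ε
  have hdC := hasDerivAt_dcharCubic_eps Δ tpd tpp c x y ε
  have := (hdL.mul hM).add (hL.mul hdC)
  unfold resolventNum
  refine this.congr_deriv ?_
  unfold dresolventNum; ring

/-- The numerator of `(axialLin/minor4S)″·minor4S³`: `8u·m² + 2·axialLin·m·(3ε + 2Δ + 4t_pp′u) + 2·resolventNum·∂_εcharCubic`. [folklore] -/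
def resolventConv (Δ tpd tpp c x y ε : ℝ) : ℝ :=
  8 * (x + y) * minor4S Δ tpd tpp c x y ε ^ 2
    + 2 * axialLin Δ tpd tpp c x y ε * minor4S Δ tpd tpp c x y ε * (3 * ε + 2 * Δ + 4 * c * (x + y))
    + 2 * resolventNum Δ tpd tpp c x y ε * dcharCubic Δ tpd tpp c x y ε

/-- **`∂_ε (resolventNum/minor4S²) = resolventConv/minor4S³`** (`minor4S ≠ 0`). [folklore] -/
theorem hasDerivAt_resolventSlope {Δ tpd tpp c x y ε : ℝ} (hm : minor4S Δ tpd tpp c x y ε ≠ 0) :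
    HasDerivAt (fun e => resolventNum Δ tpd tpp c x y e / minor4S Δ tpd tpp c x y e ^ 2)
      (resolventConv Δ tpd tpp c x y ε / minor4S Δ tpd tpp c x y ε ^ 3) ε := by
  have hN := hasDerivAt_resolventNum_eps Δ tpd tpp c x y ε
  have hM := hasDerivAt_minor4S_eps Δ tpd tpp c x y ε
  have hM2 : HasDerivAt (fun e => minor4S Δ tpd tpp c x y e ^ 2)
      (2 * minor4S Δ tpd tpp c x y ε * (-dcharCubic Δ tpd tpp c x y ε)) ε := by
    have := hM.pow 2
    refine this.congr_deriv ?_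
    norm_num
  have h := hN.div hM2 (pow_ne_zero 2 hm)
  refine h.congr_deriv ?_
  unfold resolventConv dresolventNum ddcharCubic
  field_simp
  ring

/-! ## §2 The sign regime makes the numerator non-negative -/

/-- **`resolventConv ≥ 0` in the sign regime** (`x, y ≥ 0`, `minor4S ≥ 0`, `axialLin ≥ 0`, `∂_εcharCubic ≥ 0`, `3ε + 2Δ + 4t_pp′u ≥ 0`). [folklore] -/
theorem resolventConv_nonneg {Δ tpd tpp c x y ε : ℝ} (hx : 0 ≤ x) (hy : 0 ≤ y) (hm : 0 ≤ minor4S Δ tpd tpp c x y ε)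
    (hL : 0 ≤ axialLin Δ tpd tpp c x y ε) (hdC : 0 ≤ dcharCubic Δ tpd tpp c x y ε) (hq : 0 ≤ 3 * ε + 2 * Δ + 4 * c * (x + y)) :
    0 ≤ resolventConv Δ tpd tpp c x y ε := by
  have hN := resolventNum_nonneg (Δ := Δ) (tpd := tpd) (tpp := tpp) (c := c) (ε := ε) hx hy
  unfold resolventConv
  positivity

/-! ## §3 Convexity of `axialLin/minor4S` on a window in the sign regime -/

/-- `d(axialLin/minor4S)/dε = resolventNum/minor4S²` (`minor4S ≠ 0`). [folklore] -/
theorem hasDerivAt_resolvent {Δ tpd tpp c x y ε : ℝ} (hm : minor4S Δ tpd tpp c x y ε ≠ 0) :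
    HasDerivAt (fun e => axialLin Δ tpd tpp c x y e / minor4S Δ tpd tpp c x y e)
      (resolventNum Δ tpd tpp c x y ε / minor4S Δ tpd tpp c x y ε ^ 2) ε := by
  have h := (hasDerivAt_axialLin_eps Δ tpd tpp c x y ε).div (hasDerivAt_minor4S_eps Δ tpd tpp c x y ε) hm
  refine h.congr_deriv ?_
  unfold resolventNum; ring

/-- **CONVEXITY**: on `[a, b]` at fixed `k` with `minor4S > 0`, `axialLin ≥ 0`, `∂_εcharCubic ≥ 0`, `3ε + 2Δ + 4t_pp′u ≥ 0` throughout and `x, y ≥ 0`, the resolvent function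
`ε ↦ axialLin/minor4S` is convex. [folklore] -/
theorem resolvent_convexOn {Δ tpd tpp c x y a b : ℝ} (hx : 0 ≤ x) (hy : 0 ≤ y)
    (hm : ∀ e ∈ Icc a b, 0 < minor4S Δ tpd tpp c x y e) (hL : ∀ e ∈ Icc a b, 0 ≤ axialLin Δ tpd tpp c x y e)
    (hdC : ∀ e ∈ Icc a b, 0 ≤ dcharCubic Δ tpd tpp c x y e) (hq : ∀ e ∈ Icc a b, 0 ≤ 3 * e + 2 * Δ + 4 * c * (x + y)) :
    ConvexOn ℝ (Icc a b) (fun e => axialLin Δ tpd tpp c x y e / minor4S Δ tpd tpp c x y e) := by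
  -- the function, its derivative `g = N/m²`, and `g′ = resolventConv/m³ ≥ 0`
  have hder : ∀ e ∈ Icc a b, HasDerivAt (fun e => axialLin Δ tpd tpp c x y e / minor4S Δ tpd tpp c x y e)
      (resolventNum Δ tpd tpp c x y e / minor4S Δ tpd tpp c x y e ^ 2) e := fun e he => hasDerivAt_resolvent (hm e he).ne'
  have hcont : ContinuousOn (fun e => axialLin Δ tpd tpp c x y e / minor4S Δ tpd tpp c x y e) (Icc a b) :=
    fun e he => (hder e he).continuousAt.continuousWithinAt
  have hdiff : DifferentiableOn ℝ (fun e => axialLin Δ tpd tpp c x y e / minor4S Δ tpd tpp c x y e) (interior (Icc a b)) :=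
    fun e he => (hder e (interior_subset he)).differentiableAt.differentiableWithinAt
  -- monotonicity of g on the interior
  have hgder : ∀ e ∈ Ioo a b, HasDerivAt (fun e => resolventNum Δ tpd tpp c x y e / minor4S Δ tpd tpp c x y e ^ 2)
      (resolventConv Δ tpd tpp c x y e / minor4S Δ tpd tpp c x y e ^ 3) e :=
    fun e he => hasDerivAt_resolventSlope (hm e (Ioo_subset_Icc_self he)).ne'
  have hgmono : MonotoneOn (fun e => resolventNum Δ tpd tpp c x y e / minor4S Δ tpd tpp c x y e ^ 2) (Ioo a b) := by
    apply monotoneOn_of_deriv_nonneg (convex_Ioo a b)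
    · exact fun e he => (hgder e he).continuousAt.continuousWithinAt
    · rw [interior_Ioo]; exact fun e he => (hgder e he).differentiableAt.differentiableWithinAt
    · rw [interior_Ioo]; intro e he
      rw [(hgder e he).deriv]
      have he' := Ioo_subset_Icc_self he
      exact div_nonneg (resolventConv_nonneg hx hy (hm e he').le (hL e he') (hdC e he') (hq e he')) (pow_nonneg (hm e he').le 3)
  have heq : EqOn (deriv (fun e => axialLin Δ tpd tpp c x y e / minor4S Δ tpd tpp c x y e))
      (fun e => resolventNum Δ tpd tpp c x y e / minor4S Δ tpd tpp c x y e ^ 2) (interior (Icc a b)) := by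
    intro e he; exact (hder e (interior_subset he)).deriv
  have hmono' : MonotoneOn (deriv (fun e => axialLin Δ tpd tpp c x y e / minor4S Δ tpd tpp c x y e)) (interior (Icc a b)) := by
    rw [interior_Icc]
    exact (hgmono.congr (fun e he => (heq (by rw [interior_Icc]; exact he)).symm))
  exact MonotoneOn.convexOn_of_deriv (convex_Icc a b) hcont hdiff hmono'

/-! ## §4 The Hellmann–Feynman bracket theorem -/

/-- **THE HELLMANN–FEYNMAN BRACKET IN THE SIGN REGIME**: two band points `(ε₁; ℓ₁)`, `(ε₂; ℓ₂)` at the same `k`, `T > 0`, `ε₁ < ε₂`, `x, y ≥ 0`, with `minor4S > 0`, `axialLin ≥ 0`,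
`∂_εcharCubic ≥ 0`, `3ε + 2Δ + 4t_pp′u ≥ 0` on `[ε₁, ε₂]`: `(ℓ₂ − ℓ₁)·w_s(state 2) ≤ ε₂ − ε₁ ≤ (ℓ₂ − ℓ₁)·w_s(state 1)`. [folklore] -/
theorem hf_bracket_of_signs {Δ tpd tpp c T x y ℓ₁ ℓ₂ ε₁ ε₂ : ℝ} (hx : 0 ≤ x) (hy : 0 ≤ y) (hT : 0 < T)
    (r₁ : sec4 Δ ℓ₁ tpd tpp c T x y ε₁ = 0) (r₂ : sec4 Δ ℓ₂ tpd tpp c T x y ε₂ = 0) (hlt : ε₁ < ε₂)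
    (hm : ∀ e ∈ Icc ε₁ ε₂, 0 < minor4S Δ tpd tpp c x y e) (hL : ∀ e ∈ Icc ε₁ ε₂, 0 ≤ axialLin Δ tpd tpp c x y e)
    (hdC : ∀ e ∈ Icc ε₁ ε₂, 0 ≤ dcharCubic Δ tpd tpp c x y e) (hq : ∀ e ∈ Icc ε₁ ε₂, 0 ≤ 3 * e + 2 * Δ + 4 * c * (x + y)) :
    (ℓ₂ - ℓ₁) * sWeight4 Δ ℓ₂ tpd tpp c T x y ε₂ ≤ ε₂ - ε₁ ∧ ε₂ - ε₁ ≤ (ℓ₂ - ℓ₁) * sWeight4 Δ ℓ₁ tpd tpp c T x y ε₁ := by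
  have hconv := resolvent_convexOn hx hy hm hL hdC hq
  have h₁ : ε₁ ∈ Icc ε₁ ε₂ := left_mem_Icc.mpr hlt.le
  have h₂ : ε₂ ∈ Icc ε₁ ε₂ := right_mem_Icc.mpr hlt.le
  have hm₁ := hm ε₁ h₁
  have hm₂ := hm ε₂ h₂
  -- the secant slope of `axialLin/minor4S` is `resolventDD/(m₁m₂)`
  have hslope : slope (fun e => axialLin Δ tpd tpp c x y e / minor4S Δ tpd tpp c x y e) ε₁ ε₂ =
      resolventDD Δ tpd tpp c x y ε₁ ε₂ / (minor4S Δ tpd tpp c x y ε₁ * minor4S Δ tpd tpp c x y ε₂) := by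
    rw [slope_def_field]
    have hd := axialLin_mul_minor4S_sub Δ tpd tpp c x y ε₁ ε₂
    have hne : ε₂ - ε₁ ≠ 0 := by linarith
    rw [div_sub_div _ _ hm₂.ne' hm₁.ne', div_div, div_eq_div_iff (by positivity) (by positivity)]
    linear_combination (minor4S Δ tpd tpp c x y ε₁ * minor4S Δ tpd tpp c x y ε₂) * hd
  -- tangent ≤ secant at ε₁; secant ≤ tangent at ε₂
  have hlow := hconv.le_slope_of_hasDerivAt h₁ h₂ hlt (hasDerivAt_resolvent hm₁.ne')
  have hup := hconv.slope_le_of_hasDerivAt h₁ h₂ hlt (hasDerivAt_resolvent hm₂.ne')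
  rw [hslope] at hlow hup
  constructor
  · -- lower HF bound ⟸ m₂·DD ≤ m₁·N₂
    apply (hf_lower_iff hx hy r₁ r₂ hlt hm₁ hm₂ hT).mpr
    rw [div_le_div_iff₀ (by positivity) (by positivity)] at hup
    nlinarith [hup, hm₁, hm₂]
  · -- upper HF bound ⟸ m₂·N₁ ≤ m₁·DD
    apply (hf_upper_iff hx hy r₁ r₂ hlt hm₁ hm₂ hT).mpr
    rw [div_le_div_iff₀ (by positivity) (by positivity)] at hlow
    nlinarith [hlow, hm₁, hm₂]

/-- **BILAYER, PURE `s–s`**: in the sign regime on `[ε_odd, ε_even]`, the EXACT splitting at fixed `k` lies between `2t⊥_ss·w_s(even state)` and `2t⊥_ss·w_s(odd state)`.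
[cite: AndersenEtAl1995, Eq. (24)] -/
theorem bilayer_hf_bracket {Δ εs tpd tpp c tsp tss x y εe εo : ℝ} (hx : 0 ≤ x) (hy : 0 ≤ y) (htsp : tsp ≠ 0)
    (re : sec4 Δ (εs + tss) tpd tpp c (tsp ^ 2) x y εe = 0) (ro : sec4 Δ (εs - tss) tpd tpp c (tsp ^ 2) x y εo = 0) (hlt : εo < εe)
    (hm : ∀ e ∈ Icc εo εe, 0 < minor4S Δ tpd tpp c x y e) (hL : ∀ e ∈ Icc εo εe, 0 ≤ axialLin Δ tpd tpp c x y e)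
    (hdC : ∀ e ∈ Icc εo εe, 0 ≤ dcharCubic Δ tpd tpp c x y e) (hq : ∀ e ∈ Icc εo εe, 0 ≤ 3 * e + 2 * Δ + 4 * c * (x + y)) :
    2 * tss * sWeight4 Δ (εs + tss) tpd tpp c (tsp ^ 2) x y εe ≤ εe - εo ∧
      εe - εo ≤ 2 * tss * sWeight4 Δ (εs - tss) tpd tpp c (tsp ^ 2) x y εo := by
  have h := hf_bracket_of_signs hx hy (by positivity) ro re hlt hm hL hdC hq
  have e : εs + tss - (εs - tss) = 2 * tss := by ring
  rw [e] at h
  exact h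

/-! ## §5 The inverse reading: the interlayer hopping from an exact splitting (appended 2026-08-30, mod-4 g32; §1–§4 byte-stable) -/

/-- **READING `t⊥_ss` FROM THE EXACT SPLITTING** (pure `s–s`, sign regime, both state weights positive): the interlayer Cu-4s hopping that produces the exact
splitting `Δε = ε_e − ε_o` at fixed `k` is bracketed by **`Δε/(2·w_s(odd state)) ≤ t⊥_ss ≤ Δε/(2·w_s(even state))`** — a one-band `tperp` row read back to the
four-orbital coupling carries the two sheets' Cu-4s weights as an explicit two-sided inflation, never a point value. [cite: AndersenEtAl1995, Eq. (24)] -/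
theorem tss_bracket_of_exact_split {Δ εs tpd tpp c tsp tss x y εe εo : ℝ} (hx : 0 ≤ x) (hy : 0 ≤ y) (htsp : tsp ≠ 0)
    (re : sec4 Δ (εs + tss) tpd tpp c (tsp ^ 2) x y εe = 0) (ro : sec4 Δ (εs - tss) tpd tpp c (tsp ^ 2) x y εo = 0) (hlt : εo < εe)
    (hm : ∀ e ∈ Icc εo εe, 0 < minor4S Δ tpd tpp c x y e) (hL : ∀ e ∈ Icc εo εe, 0 ≤ axialLin Δ tpd tpp c x y e)
    (hdC : ∀ e ∈ Icc εo εe, 0 ≤ dcharCubic Δ tpd tpp c x y e) (hq : ∀ e ∈ Icc εo εe, 0 ≤ 3 * e + 2 * Δ + 4 * c * (x + y))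
    (hwe : 0 < sWeight4 Δ (εs + tss) tpd tpp c (tsp ^ 2) x y εe) (hwo : 0 < sWeight4 Δ (εs - tss) tpd tpp c (tsp ^ 2) x y εo) :
    (εe - εo) / (2 * sWeight4 Δ (εs - tss) tpd tpp c (tsp ^ 2) x y εo) ≤ tss ∧
      tss ≤ (εe - εo) / (2 * sWeight4 Δ (εs + tss) tpd tpp c (tsp ^ 2) x y εe) := by
  obtain ⟨h1, h2⟩ := bilayer_hf_bracket hx hy htsp re ro hlt hm hL hdC hq
  constructor
  · rw [div_le_iff₀ (by positivity)]; linarith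
  · rw [le_div_iff₀ (by positivity)]; linarith

/-- The WIDTH of that reading relative to its lower end is the relative weight difference of the two sheets: `upper/lower = w_s(odd state)/w_s(even state)`.
[folklore] -/
theorem tss_bracket_ratio {Δ εs tpd tpp c tsp tss x y εe εo : ℝ} (hne : εe - εo ≠ 0)
    (hwe : sWeight4 Δ (εs + tss) tpd tpp c (tsp ^ 2) x y εe ≠ 0) (hwo : sWeight4 Δ (εs - tss) tpd tpp c (tsp ^ 2) x y εo ≠ 0) :
    ((εe - εo) / (2 * sWeight4 Δ (εs + tss) tpd tpp c (tsp ^ 2) x y εe)) /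
        ((εe - εo) / (2 * sWeight4 Δ (εs - tss) tpd tpp c (tsp ^ 2) x y εo)) =
      sWeight4 Δ (εs - tss) tpd tpp c (tsp ^ 2) x y εo / sWeight4 Δ (εs + tss) tpd tpp c (tsp ^ 2) x y εe := by
  field_simp

end Summit.Ventures.CertifiedManyBodySolver.Downfold.Emery
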